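import Summits.Schanuel.Schanuel.Theorems.RootDecomp1PowerLineOrder01

/-!
# RootDecomp1PowerLineOrder — lens 1, generation 32 «POWER-LINE LADDER», part 2 of the kernel (RootDecomp1PowerLineOrder.lean b1550f11…, 602 l) — continuation (RootDecomp1PowerLineOrder02): §5b the moment curve at every level `sb_momentCurve_of_liouvilleOrder`; §6 item D's power-line cell down to exponential order 17 (`powerValueTwo_of_liouvilleOrder`, `disjointSaturatedEssentialSchanuel_powerTriple_of_liouvilleOrder`, `_NW`, `liouvilleOrder_seventeen_of_hyperLiouville`)

(lens-1 g32 `RootDecomp1PowerLineOrder.lean`, sha256 b1550f115a5d…, farm rc 0 · 0 warn · 0 sorry · axioms std; critic VERDICT STATUS L1599 (e): PORT GO LOW census lane,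
`--supports stmt-Schanuel-30353`; port by census-1 gen 14 in two parts RootDecomp1PowerLineOrder01/02 (cut at §5b; the two `set_option linter.*` lines dropped); statements and proofs verbatim;
binders hX / hNW by name as written. Nothing here proves Schanuel; rung 0.)
-/

noncomputable section

open Complex IntermediateField Filter Polynomial

namespace Summit.Schanuel.Schanuel.Theorems.RootDecomp1PowerLineLadder

open Summit.Schanuel.Schanuel.Theorems.RootDecomp1KHyper
open Summit.Schanuel.Schanuel.Theorems.RootDecomp1KHyper.HyperCell
open Summit.Schanuel.Schanuel.Theorems.RootDecomp1KGeneric (LiouvilleOrder)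
open Summit.Schanuel.Schanuel.Theorems.RootDecomp1AdditiveCellsD (powerTriple disjointSchanuel_powerTriple_iff)
open Literature.NumberTheory.Transcendental (NesterenkoWaldschmidt1996_thm_5_1)

variable {n K : ℕ}

/-! ## §5b  The moment curve at every level `n`, any sign, finite order (cf. lens 6 `sb_momentCurve`) -/

/-- **Schanuel's bound on the moment curve `z = (ℓ, ℓ², …, ℓⁿ)` for every real `ℓ` of exponential order
`7n + 3` (any sign; mod `hX`)** — lens 6's `sb_momentCurve` with `HyperLiouville ℓ` (every order) weakened to the
FIXED order `LiouvilleOrder (6n+1+n+1+1) ℓ`.  For `n ≥ 1` these reals are irrational, so `z` is ℚ-free; those that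
are not hyper-Liouville lie in the scope of `FiniteOrderLiouvilleSchanuel` (stmt-Schanuel-33364), level `n`. -/
theorem sb_momentCurve_of_liouvilleOrder (hX : ExplicitRatExpApprox) {ℓ : ℝ} (n : ℕ)
    (hℓ : LiouvilleOrder (6 * n + 1 + n + 1 + 1) ℓ) :
    SB n (fun i : Fin n => (ℓ : ℂ) ^ ((i : ℕ) + 1)) := by
  rcases Nat.eq_zero_or_pos n with hn | hn
  · subst hn
    show ((0 : ℕ) : Cardinal) ≤ _
    rw [Nat.cast_zero]; exact zero_le
  set z : Fin n → ℂ := fun i => (ℓ : ℂ) ^ ((i : ℕ) + 1) with hz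
  have hz0 : z ⟨0, hn⟩ = (ℓ : ℂ) := by simp [hz]
  have hmemℓ : (ℓ : ℂ) ∈ adjoin ℚ (SFset z ∪ {I}) := mem_adjoin_SFset_I' (Or.inl ⟨⟨0, hn⟩, hz0⟩)
  have hmeme : ∀ i : Fin n, cexp ((ℓ : ℂ) ^ ((i : ℕ) + 1)) ∈ adjoin ℚ (SFset z ∪ {I}) := fun i =>
    mem_adjoin_SFset_I' (Or.inr ⟨i, rfl⟩)
  have hk3 : 3 ≤ 6 * n + 1 + n + 1 + 1 := by omega
  rcases lt_or_gt_of_ne (hℓ.irrational hk3).ne_zero with hneg | hpos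
  · have hai := algebraicIndependent_curvePt_of_liouvilleOrder hX n hℓ.neg (neg_pos.mpr hneg)
    refine sb_of_algebraicIndependent hai (by simp) fun k => ?_
    refine Fin.cases ?_ (fun i => ?_) k
    · simp only [curvePt, Fin.cons_zero]
      rw [Complex.ofReal_neg]; exact neg_mem hmemℓ
    · simp only [curvePt, Fin.cons_succ]
      rw [Complex.ofReal_neg]
      rcases Nat.even_or_odd ((i : ℕ) + 1) with he | ho
      · rw [he.neg_pow]; exact hmeme i
      · rw [ho.neg_pow, Complex.exp_neg]; exact inv_mem (hmeme i)
  · have hai := algebraicIndependent_curvePt_of_liouvilleOrder hX n hℓ hpos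
    refine sb_of_algebraicIndependent hai (by simp) fun k => ?_
    refine Fin.cases ?_ (fun i => ?_) k
    · simp only [curvePt, Fin.cons_zero]; exact hmemℓ
    · simp only [curvePt, Fin.cons_succ]; exact hmeme i

/-! ## §6  Item D's power-line cell down to exponential order `17` -/

/-- `k` algebraically independent members of an intermediate field give it transcendence degree `≥ k`. -/
private theorem natCast_le_trdeg' {k : ℕ} {L : IntermediateField ℚ ℂ} {v : Fin k → ℂ}
    (hv : AlgebraicIndependent ℚ v) (hmem : ∀ i, v i ∈ L) : (k : Cardinal) ≤ Algebra.trdeg ℚ ↥L := by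
  let y : Fin k → ↥L := fun i => ⟨v i, hmem i⟩
  have hy : AlgebraicIndependent ℚ y := AlgebraicIndependent.of_comp L.val hv
  simpa using hy.cardinalMk_le_trdeg

/-- `(w, w², w³) = (w^{0+1}, w^{1+1}, w^{2+1})` (as in part 1). -/
private theorem powerTriple_eq_momentCurve' (w : ℂ) : powerTriple w = fun i : Fin 3 => w ^ ((i : ℕ) + 1) := by
  funext i
  fin_cases i <;> simp [powerTriple]

/-- **`ℓ, e^ℓ, e^{ℓ²}` algebraically independent for every real `ℓ > 0` of exponential order `17`** (mod `hX`). -/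
theorem algebraicIndependent_curvePt_two_of_liouvilleOrder (hX : ExplicitRatExpApprox) {ℓ : ℝ}
    (hℓ : LiouvilleOrder 17 ℓ) (hℓ0 : 0 < ℓ) : AlgebraicIndependent ℚ (curvePt 2 (ℓ : ℂ)) :=
  algebraicIndependent_curvePt_of_liouvilleOrder hX 2 hℓ hℓ0

/-- **PowerValueTwo(ℓ) for every real `ℓ > 0` of exponential order `17`** (mod `hX`):
`2 ≤ trdeg ℚ(e^ℓ, e^{ℓ²}, e^{ℓ³})`, from the algebraic independence of `e^ℓ, e^{ℓ²}`. -/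
theorem powerValueTwo_of_liouvilleOrder (hX : ExplicitRatExpApprox) {ℓ : ℝ} (hℓ : LiouvilleOrder 17 ℓ)
    (hℓ0 : 0 < ℓ) :
    (2 : Cardinal) ≤ Algebra.trdeg ℚ ↥(adjoin ℚ (Set.range (cexp ∘ powerTriple (ℓ : ℂ)))) := by
  have hai := (algebraicIndependent_curvePt_two_of_liouvilleOrder hX hℓ hℓ0).comp Fin.succ (Fin.succ_injective 2)
  have hmem : ∀ i : Fin 2, (curvePt 2 (ℓ : ℂ) ∘ Fin.succ) i ∈ adjoin ℚ (Set.range (cexp ∘ powerTriple (ℓ : ℂ))) := by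
    intro i
    refine subset_adjoin ℚ _ ⟨⟨(i : ℕ), by omega⟩, ?_⟩
    simp [curvePt, powerTriple_eq_momentCurve']
  have h := natCast_le_trdeg' hai hmem
  exact_mod_cast h

/-- **Schanuel's bound at the power line `(ℓ, ℓ², ℓ³)` for every real `ℓ > 0` of exponential order `17`**
(mod `hX`): `3 ≤ trdeg ℚ(ℓ, ℓ², ℓ³, e^ℓ, e^{ℓ²}, e^{ℓ³})`, from the algebraic independence of `ℓ, e^ℓ, e^{ℓ²}`. -/
theorem sb_powerTriple_of_liouvilleOrder (hX : ExplicitRatExpApprox) {ℓ : ℝ} (hℓ : LiouvilleOrder 17 ℓ)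
    (hℓ0 : 0 < ℓ) : SB 3 (powerTriple (ℓ : ℂ)) := by
  have hai := algebraicIndependent_curvePt_two_of_liouvilleOrder hX hℓ hℓ0
  have hmem : ∀ i : Fin 3, curvePt 2 (ℓ : ℂ) i ∈
      adjoin ℚ (Set.range (powerTriple (ℓ : ℂ)) ∪ Set.range (cexp ∘ powerTriple (ℓ : ℂ))) := by
    intro i
    refine subset_adjoin ℚ _ ?_
    refine Fin.cases ?_ (fun j => ?_) i
    · exact Or.inl ⟨0, by simp [curvePt, powerTriple]⟩
    · exact Or.inr ⟨⟨(j : ℕ), by omega⟩, by simp [curvePt, powerTriple_eq_momentCurve']⟩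
  exact natCast_le_trdeg' hai hmem

/-- **ITEM D = `DisjointSaturatedEssentialSchanuel` (stmt-Schanuel-30353), binders VERBATIM, cell
`n ≤ 3 ∧ range z = range (ℓ, ℓ², ℓ³)` inserted after `LinearIndependent ℚ z`, HOLDS for every real `ℓ > 0` of
exponential Liouville order `17`** (mod `hX`) — one rung below part 1's hyper-Liouville class. -/
theorem disjointSaturatedEssentialSchanuel_powerTriple_of_liouvilleOrder (hX : ExplicitRatExpApprox) {ℓ : ℝ}
    (hℓ : LiouvilleOrder 17 ℓ) (hℓ0 : 0 < ℓ) :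
    ∀ (n : ℕ), 3 ≤ n → ∀ (z : Fin n → ℂ), LinearIndependent ℚ z →
      (n ≤ 3 ∧ Set.range z = Set.range (powerTriple (ℓ : ℂ))) →
      (∀ i, z i ∈ Literature.NumberTheory.Transcendental.ecl (∅ : Set ℂ)) →
      (∀ (m : ℕ), m < n → ∀ (w : Fin m → ℂ), LinearIndependent ℚ w →
        (∀ i, w i ∈ Submodule.span ℚ (Set.range z)) →
        (m : Cardinal) ≤ Algebra.trdeg ℚ ↥(IntermediateField.adjoin ℚ (Set.range w ∪ Set.range (Complex.exp ∘ w)))) →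
      (∀ w : ℂ, IsAlgebraic ↥(IntermediateField.adjoin ℚ (Set.range z ∪ Set.range (Complex.exp ∘ z))) w →
        IsAlgebraic ↥(IntermediateField.adjoin ℚ (Set.range z ∪ Set.range (Complex.exp ∘ z))) (Complex.exp w) →
        w ∈ Submodule.span ℚ (Set.range z)) →
      (∀ (k : ℕ) (t : Fin k → ℂ) (β₀ γ₀ : Fin n → ℂ) (β γ : Fin n → Fin k → ℂ), (∀ i, IsAlgebraic ℚ (β₀ i)) →
        (∀ i j, IsAlgebraic ℚ (β i j)) → (∀ i, IsAlgebraic ℚ (γ₀ i)) → (∀ i j, IsAlgebraic ℚ (γ i j)) →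
        (∀ i, z i = β₀ i + ∑ j, β i j * t j) → (∀ i, Complex.exp (z i) = γ₀ i + ∑ j, γ i j * t j) → n ≤ k) →
      (∀ (k : ℕ) (t : Fin k → ℂ) (β₀ γ₀ : Fin n → ℂ) (β γ : Fin n → Fin k → ℂ) (δ ε : Fin n → Fin k → Fin k → ℂ),
        (∀ i, IsAlgebraic ℚ (β₀ i)) → (∀ i j, IsAlgebraic ℚ (β i j)) → (∀ i j j', IsAlgebraic ℚ (δ i j j')) →
        (∀ i, IsAlgebraic ℚ (γ₀ i)) → (∀ i j, IsAlgebraic ℚ (γ i j)) → (∀ i j j', IsAlgebraic ℚ (ε i j j')) →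
        (∀ i, z i = β₀ i + ∑ j, β i j * t j + ∑ j, ∑ j', δ i j j' * (t j * t j')) →
        (∀ i, Complex.exp (z i) = γ₀ i + ∑ j, γ i j * t j + ∑ j, ∑ j', ε i j j' * (t j * t j')) → n ≤ k) →
      (∀ (k : ℕ) (t : Fin k → ℂ) (D : MvPolynomial (Fin k) ℂ) (N E : Fin n → MvPolynomial (Fin k) ℂ),
        (∀ m, IsAlgebraic ℚ (MvPolynomial.coeff m D)) → (∀ i m, IsAlgebraic ℚ (MvPolynomial.coeff m (N i))) →
        (∀ i m, IsAlgebraic ℚ (MvPolynomial.coeff m (E i))) → MvPolynomial.eval t D ≠ 0 →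
        (∀ i, z i * MvPolynomial.eval t D = MvPolynomial.eval t (N i)) →
        (∀ i, Complex.exp (z i) * MvPolynomial.eval t D = MvPolynomial.eval t (E i)) → n ≤ k) →
      (Algebra.trdeg ℚ ↥(IntermediateField.adjoin ℚ (Set.range z)) +
          Algebra.trdeg ℚ ↥(IntermediateField.adjoin ℚ (Set.range (Complex.exp ∘ z))) ≤
        Algebra.trdeg ℚ ↥(IntermediateField.adjoin ℚ (Set.range z ∪ Set.range (Complex.exp ∘ z)))) →
      (n : Cardinal) ≤ Algebra.trdeg ℚ ↥(IntermediateField.adjoin ℚ (Set.range z ∪ Set.range (Complex.exp ∘ z))) := by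
  intro n hn z hz hcell _ _ _ _ _ _ _
  obtain rfl : n = 3 := le_antisymm hcell.1 hn
  have e1 : Set.range (Complex.exp ∘ z) = Set.range (cexp ∘ powerTriple (ℓ : ℂ)) := by
    rw [Set.range_comp, Set.range_comp, hcell.2]
  rw [e1, hcell.2]
  exact sb_powerTriple_of_liouvilleOrder hX hℓ hℓ0

/-- **Any-sign variant at order `24`:** item D (binders verbatim) on the cell `range z = range (ℓ, ℓ², ℓ³)` for
every real `ℓ` (either sign) of exponential order `24`, via the level-3 moment curve (`e^{ℓ³}` load-bearing too:
`trdeg ℚ(ℓ, e^ℓ, e^{ℓ²}, e^{ℓ³}) = 4 ≥ 3`). -/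
theorem disjointSaturatedEssentialSchanuel_powerTriple_of_liouvilleOrder' (hX : ExplicitRatExpApprox) {ℓ : ℝ}
    (hℓ : LiouvilleOrder 24 ℓ) :
    ∀ (n : ℕ), 3 ≤ n → ∀ (z : Fin n → ℂ), LinearIndependent ℚ z →
      (n ≤ 3 ∧ Set.range z = Set.range (powerTriple (ℓ : ℂ))) →
      (∀ i, z i ∈ Literature.NumberTheory.Transcendental.ecl (∅ : Set ℂ)) →
      (∀ (m : ℕ), m < n → ∀ (w : Fin m → ℂ), LinearIndependent ℚ w →
        (∀ i, w i ∈ Submodule.span ℚ (Set.range z)) →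
        (m : Cardinal) ≤ Algebra.trdeg ℚ ↥(IntermediateField.adjoin ℚ (Set.range w ∪ Set.range (Complex.exp ∘ w)))) →
      (∀ w : ℂ, IsAlgebraic ↥(IntermediateField.adjoin ℚ (Set.range z ∪ Set.range (Complex.exp ∘ z))) w →
        IsAlgebraic ↥(IntermediateField.adjoin ℚ (Set.range z ∪ Set.range (Complex.exp ∘ z))) (Complex.exp w) →
        w ∈ Submodule.span ℚ (Set.range z)) →
      (∀ (k : ℕ) (t : Fin k → ℂ) (β₀ γ₀ : Fin n → ℂ) (β γ : Fin n → Fin k → ℂ), (∀ i, IsAlgebraic ℚ (β₀ i)) →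
        (∀ i j, IsAlgebraic ℚ (β i j)) → (∀ i, IsAlgebraic ℚ (γ₀ i)) → (∀ i j, IsAlgebraic ℚ (γ i j)) →
        (∀ i, z i = β₀ i + ∑ j, β i j * t j) → (∀ i, Complex.exp (z i) = γ₀ i + ∑ j, γ i j * t j) → n ≤ k) →
      (∀ (k : ℕ) (t : Fin k → ℂ) (β₀ γ₀ : Fin n → ℂ) (β γ : Fin n → Fin k → ℂ) (δ ε : Fin n → Fin k → Fin k → ℂ),
        (∀ i, IsAlgebraic ℚ (β₀ i)) → (∀ i j, IsAlgebraic ℚ (β i j)) → (∀ i j j', IsAlgebraic ℚ (δ i j j')) →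
        (∀ i, IsAlgebraic ℚ (γ₀ i)) → (∀ i j, IsAlgebraic ℚ (γ i j)) → (∀ i j j', IsAlgebraic ℚ (ε i j j')) →
        (∀ i, z i = β₀ i + ∑ j, β i j * t j + ∑ j, ∑ j', δ i j j' * (t j * t j')) →
        (∀ i, Complex.exp (z i) = γ₀ i + ∑ j, γ i j * t j + ∑ j, ∑ j', ε i j j' * (t j * t j')) → n ≤ k) →
      (∀ (k : ℕ) (t : Fin k → ℂ) (D : MvPolynomial (Fin k) ℂ) (N E : Fin n → MvPolynomial (Fin k) ℂ),
        (∀ m, IsAlgebraic ℚ (MvPolynomial.coeff m D)) → (∀ i m, IsAlgebraic ℚ (MvPolynomial.coeff m (N i))) →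
        (∀ i m, IsAlgebraic ℚ (MvPolynomial.coeff m (E i))) → MvPolynomial.eval t D ≠ 0 →
        (∀ i, z i * MvPolynomial.eval t D = MvPolynomial.eval t (N i)) →
        (∀ i, Complex.exp (z i) * MvPolynomial.eval t D = MvPolynomial.eval t (E i)) → n ≤ k) →
      (Algebra.trdeg ℚ ↥(IntermediateField.adjoin ℚ (Set.range z)) +
          Algebra.trdeg ℚ ↥(IntermediateField.adjoin ℚ (Set.range (Complex.exp ∘ z))) ≤
        Algebra.trdeg ℚ ↥(IntermediateField.adjoin ℚ (Set.range z ∪ Set.range (Complex.exp ∘ z)))) →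
      (n : Cardinal) ≤ Algebra.trdeg ℚ ↥(IntermediateField.adjoin ℚ (Set.range z ∪ Set.range (Complex.exp ∘ z))) := by
  intro n hn z hz hcell _ _ _ _ _ _ _
  obtain rfl : n = 3 := le_antisymm hcell.1 hn
  have e1 : Set.range (Complex.exp ∘ z) = Set.range (cexp ∘ powerTriple (ℓ : ℂ)) := by
    rw [Set.range_comp, Set.range_comp, hcell.2]
  rw [e1, hcell.2]
  have h := sb_momentCurve_of_liouvilleOrder hX 3 hℓ
  rw [← powerTriple_eq_momentCurve'] at h
  exact h

/-- **Registered-fact form:** the same, modulo ONLY `NesterenkoWaldschmidt1996_thm_5_1`. -/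
theorem disjointSaturatedEssentialSchanuel_powerTriple_of_liouvilleOrder_NW
    (hNW : NesterenkoWaldschmidt1996_thm_5_1) {ℓ : ℝ} (hℓ : LiouvilleOrder 17 ℓ) (hℓ0 : 0 < ℓ) :
    ∀ (n : ℕ), 3 ≤ n → ∀ (z : Fin n → ℂ), LinearIndependent ℚ z →
      (n ≤ 3 ∧ Set.range z = Set.range (powerTriple (ℓ : ℂ))) →
      (∀ i, z i ∈ Literature.NumberTheory.Transcendental.ecl (∅ : Set ℂ)) →
      (∀ (m : ℕ), m < n → ∀ (w : Fin m → ℂ), LinearIndependent ℚ w →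
        (∀ i, w i ∈ Submodule.span ℚ (Set.range z)) →
        (m : Cardinal) ≤ Algebra.trdeg ℚ ↥(IntermediateField.adjoin ℚ (Set.range w ∪ Set.range (Complex.exp ∘ w)))) →
      (∀ w : ℂ, IsAlgebraic ↥(IntermediateField.adjoin ℚ (Set.range z ∪ Set.range (Complex.exp ∘ z))) w →
        IsAlgebraic ↥(IntermediateField.adjoin ℚ (Set.range z ∪ Set.range (Complex.exp ∘ z))) (Complex.exp w) →
        w ∈ Submodule.span ℚ (Set.range z)) →
      (∀ (k : ℕ) (t : Fin k → ℂ) (β₀ γ₀ : Fin n → ℂ) (β γ : Fin n → Fin k → ℂ), (∀ i, IsAlgebraic ℚ (β₀ i)) →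
        (∀ i j, IsAlgebraic ℚ (β i j)) → (∀ i, IsAlgebraic ℚ (γ₀ i)) → (∀ i j, IsAlgebraic ℚ (γ i j)) →
        (∀ i, z i = β₀ i + ∑ j, β i j * t j) → (∀ i, Complex.exp (z i) = γ₀ i + ∑ j, γ i j * t j) → n ≤ k) →
      (∀ (k : ℕ) (t : Fin k → ℂ) (β₀ γ₀ : Fin n → ℂ) (β γ : Fin n → Fin k → ℂ) (δ ε : Fin n → Fin k → Fin k → ℂ),
        (∀ i, IsAlgebraic ℚ (β₀ i)) → (∀ i j, IsAlgebraic ℚ (β i j)) → (∀ i j j', IsAlgebraic ℚ (δ i j j')) →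
        (∀ i, IsAlgebraic ℚ (γ₀ i)) → (∀ i j, IsAlgebraic ℚ (γ i j)) → (∀ i j j', IsAlgebraic ℚ (ε i j j')) →
        (∀ i, z i = β₀ i + ∑ j, β i j * t j + ∑ j, ∑ j', δ i j j' * (t j * t j')) →
        (∀ i, Complex.exp (z i) = γ₀ i + ∑ j, γ i j * t j + ∑ j, ∑ j', ε i j j' * (t j * t j')) → n ≤ k) →
      (∀ (k : ℕ) (t : Fin k → ℂ) (D : MvPolynomial (Fin k) ℂ) (N E : Fin n → MvPolynomial (Fin k) ℂ),
        (∀ m, IsAlgebraic ℚ (MvPolynomial.coeff m D)) → (∀ i m, IsAlgebraic ℚ (MvPolynomial.coeff m (N i))) →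
        (∀ i m, IsAlgebraic ℚ (MvPolynomial.coeff m (E i))) → MvPolynomial.eval t D ≠ 0 →
        (∀ i, z i * MvPolynomial.eval t D = MvPolynomial.eval t (N i)) →
        (∀ i, Complex.exp (z i) * MvPolynomial.eval t D = MvPolynomial.eval t (E i)) → n ≤ k) →
      (Algebra.trdeg ℚ ↥(IntermediateField.adjoin ℚ (Set.range z)) +
          Algebra.trdeg ℚ ↥(IntermediateField.adjoin ℚ (Set.range (Complex.exp ∘ z))) ≤
        Algebra.trdeg ℚ ↥(IntermediateField.adjoin ℚ (Set.range z ∪ Set.range (Complex.exp ∘ z)))) →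
      (n : Cardinal) ≤ Algebra.trdeg ℚ ↥(IntermediateField.adjoin ℚ (Set.range z ∪ Set.range (Complex.exp ∘ z))) :=
  disjointSaturatedEssentialSchanuel_powerTriple_of_liouvilleOrder (explicitRatExpApprox_of_NW1996 hNW) hℓ hℓ0

/-- The hyper-Liouville class is INSIDE the order-17 class (the ladder is nested):
`HyperLiouville ℓ → LiouvilleOrder 17 ℓ` (lens 6, `LiouvilleOrder.of_hyperLiouville`). -/
theorem liouvilleOrder_seventeen_of_hyperLiouville {ℓ : ℝ} (hℓ : HyperLiouville ℓ) : LiouvilleOrder 17 ℓ :=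
  Summit.Schanuel.Schanuel.Theorems.RootDecomp1KGeneric.LiouvilleOrder.of_hyperLiouville hℓ 17

end Summit.Schanuel.Schanuel.Theorems.RootDecomp1PowerLineLadder
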